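import Mathlib.Algebra.MvPolynomial.PDeriv
import Mathlib.Data.Fin.VecNotation
import Mathlib.Data.ZMod.Basic
import Mathlib.RingTheory.Ideal.Operations
import Mathlib.Tactic.LinearCombination
import Summits.ResolutionOfSingularities.ResolutionOfSingularities.Theorems.EquisingularLiftEquisingularLiftNatResidueHypDefsE
import HarnessLib

/-!
# [OURS · L1 W4.5(b) · EL♮(3)] Specimen S_ν(G₇) — the D9 «ν3-DIRECT» customer of record: POINTWISE FACTS
# (kill side, res-L1-w45b-lead-1 g19; memo `L/res-L1-w45b-lead-1/SNU-G7-CERTIFICATE.md` f2094ef1643d0b39 + `SNU-ADDENDUM-A.md`; desk RULING R71 (i)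
# «optional kernel twin …NatSpecimenSnuG7 (pointwise facts only, like Q47's ✓ p690878)»; crux `EquisingularLiftNatThree`, stmt-ResolutionOfSingularities-20148)

NOT a statement of any manuscript; OURS kernel specimen (cell `res-hironaka`, chain w45b).  AI-written, weaker than expert review.  Nothing of [Hironaka2017]
is asserted; EL♮(3) is NOT proved here; this file does NOT prove that S_ν(G₇) lies outside any typed class — that is the by-hand certificate of the memos
(persistence + the cost ledger of ADDENDUM A).  It certifies the finitely many POINTWISE facts the certificate and the panel reads (crit-3 g9 l.85855 (R1),
crit-2 g10 l.85858) rest on, in the kernel, over `ZMod 7` (the specimen lives over `𝔽̄₇`; all facts below are identities over the prime field).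

THE OBJECT.  `S = V(F) ⊂ ℙ³`, `F = g₇² + w²·B♮₁₄`, `g₇ = y⁷z − x⁸ − 3x²z⁶ − z⁸`, `B♮₁₄ = x¹³z + xy¹³ + yz¹³ + 2x⁷y⁷ + y¹⁴ + 2z¹⁴ + w²(x¹² + y¹² + z¹²) + w¹⁴`;
variables `X 0 = x`, `X 1 = y`, `X 2 = z`, `X 3 = w`; the nose `Z = G₇ = V(w, g₇)` in the plane `Π = V(w)`; its seven cusps `q_r = (r : 4r² + 1 : 1 : 0)`, `r ∈ 𝔽₇`.
* `F_mem_sq`            : `F ∈ (w, g₇)²` — `S` is singular along all of `Z` (with kit j326241 (d): `Sing S = Z` exactly);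
* `chart_U`, `chart_V`  : the two charts of the round at `Z`: `(wU)² + w²B = w²(U² + B)`, `g² + (gV)²B = g²(1 + V²B)` (strict transforms `U² + B`, `1 + V²B`);
* `pderiv_g₇_x/y/z`, `pderiv_g₇_xx/xy/yy` : `∂ₓg₇ = −8x⁷ − 6xz⁶`, `∂_y g₇ = 7y⁶z`, `∂_z g₇ = y⁷ − 18x²z⁵ − 8z⁷`, `∂ₓₓ g₇ = −56x⁶ − 6z⁶`, `∂ₓ_y g₇ = 0`,
  `∂_yy g₇ = 42y⁵z` (any commutative ring; `pderiv_ofNat'` = a derivation kills numerals);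
* over `ZMod 7` (`g₇⁽³⁾` = `g₇` as a ternary form on `Π`): `cusp_on_curve`, `cusp_singular` (value and the three partials vanish at every `q_r`),
  `hess_entries_cusp` / `hessBlock_cusp_eq_zero` — the door ν4's Hessian block `hessBlock g₇⁽³⁾ 0 1 (q_r)` (…NatResidueHypDefsE) is `0` at every cusp (tangent cone a DOUBLE LINE,
  so no `q_r` can be a marked vector of `EqCertAt₀`), while `pderiv_xx_cusp_ne_zero` (the cone is `u²`, not `0`); `bnat_cusp` — `B♮₁₄(q_r) = 4, 6, 6, 1, 1, 1, 2`,
  all `≠ 0` (`bnat_cusp_ne_zero`: `A′ ≠ 0` at `Sing Z`, so `T̃″ = {U² + B♮ = 0}` misses the ambient-singular point `U = 0` over each cusp);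
  `strange_point` — `(0:1:0) ∈ Z` with `∂_z g₇ = 1` there (smooth point) and `B♮ = 1`;
* `restrictToHyperplane_std_w`, `restrictToHyperplane_std_g₇` — for the standard coordinates `B₀` of `Π = V(w)` the door's `restrictToHyperplane B₀`
  (…NatResidueHypDefsE) sends `w ↦ 0` and `g₇ ↦ g₇⁽³⁾` (so the statements above are literally about `restrictToHyperplane B₀ g₇`).
Measured counterpart (kit j326241, `L/res-L1-w45b-lead-1/snu7/`): `Sing G₇ = {q_r}` exactly, `g₇` and `F` absolutely irreducible, `Sing S ∩ {w ≠ 0} = ∅`,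
pinch scheme `Z ∩ V(B♮)` reduced of length 112.  `--supports stmt-ResolutionOfSingularities-20148 --as helper`; def-free; standard axioms.
-/

set_option linter.dupNamespace false -- mandated namespace `Summit.<Summit>.<Problem>` of this single-conjunct summit

noncomputable section

open MvPolynomial

namespace Summit.ResolutionOfSingularities.ResolutionOfSingularities.Cruxes.EquisingularLiftNat.Sections

namespace SpecimenSnuG7

section anyRing

variable (R : Type) [CommRing R]

/-- A derivation kills numerals: `∂_i (n) = 0` in `R[X]` (helper for the `simp` sets below). [folklore] -/
theorem pderiv_ofNat' {σ : Type} (i : σ) (n : ℕ) [n.AtLeastTwo] :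
    pderiv i (ofNat(n) : MvPolynomial σ R) = 0 := by
  rw [← map_ofNat (C : R →+* MvPolynomial σ R) n, pderiv_C]

/-- [OURS · L1 W4.5b] `F = g₇² + w²B♮₁₄ ∈ (w, g₇)²`: the surface is singular along the whole nose `Z = V(w, g₇)`. [folklore] -/
theorem F_mem_sq :
    ((X 1 ^ 7 * X 2 - X 0 ^ 8 - 3 * X 0 ^ 2 * X 2 ^ 6 - X 2 ^ 8) ^ 2 +
        X 3 ^ 2 * (X 0 ^ 13 * X 2 + X 0 * X 1 ^ 13 + X 1 * X 2 ^ 13 + 2 * X 0 ^ 7 * X 1 ^ 7 + X 1 ^ 14 + 2 * X 2 ^ 14 +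
          X 3 ^ 2 * (X 0 ^ 12 + X 1 ^ 12 + X 2 ^ 12) + X 3 ^ 14) : MvPolynomial (Fin 4) R) ∈
      (Ideal.span {(X 3 : MvPolynomial (Fin 4) R), X 1 ^ 7 * X 2 - X 0 ^ 8 - 3 * X 0 ^ 2 * X 2 ^ 6 - X 2 ^ 8}) ^ 2 := by
  have hw : (X 3 : MvPolynomial (Fin 4) R) ∈
      Ideal.span {(X 3 : MvPolynomial (Fin 4) R), X 1 ^ 7 * X 2 - X 0 ^ 8 - 3 * X 0 ^ 2 * X 2 ^ 6 - X 2 ^ 8} :=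
    Ideal.subset_span (Set.mem_insert _ _)
  have hg : (X 1 ^ 7 * X 2 - X 0 ^ 8 - 3 * X 0 ^ 2 * X 2 ^ 6 - X 2 ^ 8 : MvPolynomial (Fin 4) R) ∈
      Ideal.span {(X 3 : MvPolynomial (Fin 4) R), X 1 ^ 7 * X 2 - X 0 ^ 8 - 3 * X 0 ^ 2 * X 2 ^ 6 - X 2 ^ 8} :=
    Ideal.subset_span (Set.mem_insert_of_mem _ (Set.mem_singleton _))
  exact Ideal.add_mem _ (Ideal.pow_mem_pow hg 2) (Ideal.mul_mem_right _ _ (Ideal.pow_mem_pow hw 2))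

/-- [OURS · L1 W4.5b] Chart `g = wU` of the round at `Z = V(w, g)`: `(wU)² + w²B = w²·(U² + B)` — strict transform `U² + B`; over a point with `B ≠ 0` it
misses `U = 0` (where `Bl_Z` of the ambient is singular over `Sing Z`). [folklore] -/
theorem chart_U (w U B : R) : (w * U) ^ 2 + w ^ 2 * B = w ^ 2 * (U ^ 2 + B) := by ring

/-- [OURS · L1 W4.5b] Chart `w = gV`: `g² + (gV)²B = g²·(1 + V²B)` — strict transform `1 + V²B` (no point over `B = 0`, `V` a simple root elsewhere). [folklore] -/
theorem chart_V (g V B : R) : g ^ 2 + (g * V) ^ 2 * B = g ^ 2 * (1 + V ^ 2 * B) := by ring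

/-- [OURS · L1 W4.5b] `∂ₓ g₇ = −8x⁷ − 6xz⁶` (`= −x(x⁶ − z⁶)` in characteristic 7: the cusps sit over `x/z ∈ 𝔽₇`). [folklore] -/
theorem pderiv_g₇_x :
    pderiv 0 (X 1 ^ 7 * X 2 - X 0 ^ 8 - 3 * X 0 ^ 2 * X 2 ^ 6 - X 2 ^ 8 : MvPolynomial (Fin 3) R) =
      -(8 * X 0 ^ 7) - 6 * X 0 * X 2 ^ 6 := by
  simp only [map_sub, Derivation.leibniz, Derivation.leibniz_pow, pderiv_X_self,
    pderiv_X_of_ne (i := (0 : Fin 3)) (j := 1) (by decide), pderiv_X_of_ne (i := (0 : Fin 3)) (j := 2) (by decide),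
    pderiv_ofNat', smul_eq_mul, nsmul_eq_mul, Nat.cast_ofNat, mul_one, mul_zero, zero_add, add_zero, smul_zero, sub_zero]
  ring

/-- [OURS · L1 W4.5b] `∂_y g₇ = 7y⁶z` (identically `0` in characteristic 7: `Z` is a STRANGE curve). [folklore] -/
theorem pderiv_g₇_y :
    pderiv 1 (X 1 ^ 7 * X 2 - X 0 ^ 8 - 3 * X 0 ^ 2 * X 2 ^ 6 - X 2 ^ 8 : MvPolynomial (Fin 3) R) = 7 * X 1 ^ 6 * X 2 := by
  simp only [map_sub, Derivation.leibniz, Derivation.leibniz_pow, pderiv_X_self,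
    pderiv_X_of_ne (i := (1 : Fin 3)) (j := 0) (by decide), pderiv_X_of_ne (i := (1 : Fin 3)) (j := 2) (by decide),
    pderiv_ofNat', smul_eq_mul, nsmul_eq_mul, Nat.cast_ofNat, mul_one, mul_zero, zero_add, add_zero, smul_zero, sub_zero]
  ring

/-- [OURS · L1 W4.5b] `∂_z g₇ = y⁷ − 18x²z⁵ − 8z⁷`. [folklore] -/
theorem pderiv_g₇_z :
    pderiv 2 (X 1 ^ 7 * X 2 - X 0 ^ 8 - 3 * X 0 ^ 2 * X 2 ^ 6 - X 2 ^ 8 : MvPolynomial (Fin 3) R) =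
      X 1 ^ 7 - 18 * X 0 ^ 2 * X 2 ^ 5 - 8 * X 2 ^ 7 := by
  simp only [map_sub, Derivation.leibniz, Derivation.leibniz_pow, pderiv_X_self,
    pderiv_X_of_ne (i := (2 : Fin 3)) (j := 0) (by decide), pderiv_X_of_ne (i := (2 : Fin 3)) (j := 1) (by decide),
    pderiv_ofNat', smul_eq_mul, nsmul_eq_mul, Nat.cast_ofNat, mul_one, mul_zero, add_zero, smul_zero, sub_zero]
  ring

/-- [OURS · L1 W4.5b] `∂ₓ∂ₓ g₇ = −56x⁶ − 6z⁶`. [folklore] -/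
theorem pderiv_g₇_xx :
    pderiv 0 (pderiv 0 (X 1 ^ 7 * X 2 - X 0 ^ 8 - 3 * X 0 ^ 2 * X 2 ^ 6 - X 2 ^ 8 : MvPolynomial (Fin 3) R)) =
      -(56 * X 0 ^ 6) - 6 * X 2 ^ 6 := by
  rw [pderiv_g₇_x]
  simp only [map_sub, map_neg, Derivation.leibniz, Derivation.leibniz_pow, pderiv_X_self,
    pderiv_X_of_ne (i := (0 : Fin 3)) (j := 2) (by decide), pderiv_ofNat', smul_eq_mul, nsmul_eq_mul, Nat.cast_ofNat, mul_one,
    mul_zero, zero_add, add_zero, smul_zero]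
  ring

/-- [OURS · L1 W4.5b] `∂ₓ∂_y g₇ = 0`. [folklore] -/
theorem pderiv_g₇_xy :
    pderiv 0 (pderiv 1 (X 1 ^ 7 * X 2 - X 0 ^ 8 - 3 * X 0 ^ 2 * X 2 ^ 6 - X 2 ^ 8 : MvPolynomial (Fin 3) R)) = 0 := by
  rw [pderiv_g₇_y]
  simp only [Derivation.leibniz, Derivation.leibniz_pow, pderiv_X_of_ne (i := (0 : Fin 3)) (j := 1) (by decide),
    pderiv_X_of_ne (i := (0 : Fin 3)) (j := 2) (by decide), pderiv_ofNat', smul_eq_mul, mul_zero, add_zero, smul_zero]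

/-- [OURS · L1 W4.5b] `∂_y∂_y g₇ = 42y⁵z`. [folklore] -/
theorem pderiv_g₇_yy :
    pderiv 1 (pderiv 1 (X 1 ^ 7 * X 2 - X 0 ^ 8 - 3 * X 0 ^ 2 * X 2 ^ 6 - X 2 ^ 8 : MvPolynomial (Fin 3) R)) = 42 * X 1 ^ 5 * X 2 := by
  rw [pderiv_g₇_y]
  simp only [Derivation.leibniz, Derivation.leibniz_pow, pderiv_X_self, pderiv_X_of_ne (i := (1 : Fin 3)) (j := 2) (by decide),
    pderiv_ofNat', smul_eq_mul, nsmul_eq_mul, Nat.cast_ofNat, mul_one, mul_zero, zero_add, add_zero]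
  ring

end anyRing

/-! ## Over the prime field `𝔽₇` -/

section charSeven

/-- [OURS · L1 W4.5b] Every `q_r = (r, 4r² + 1, 1)`, `r ∈ 𝔽₇`, lies on `G₇`: `g₇(q_r) = 0` (`(4r²+1)⁷ = 4r²+1 = r⁸ + 3r² + 1` in `𝔽₇`). [folklore] -/
theorem cusp_on_curve (r : ZMod 7) :
    eval ![r, 4 * r ^ 2 + 1, 1] (X 1 ^ 7 * X 2 - X 0 ^ 8 - 3 * X 0 ^ 2 * X 2 ^ 6 - X 2 ^ 8 : MvPolynomial (Fin 3) (ZMod 7)) = 0 := by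
  simp only [map_sub, map_mul, map_pow, eval_X, map_ofNat, Matrix.cons_val_zero, Matrix.cons_val_one, Matrix.cons_val_two,
    Matrix.tail_cons, Matrix.head_cons]
  revert r; decide

/-- [OURS · L1 W4.5b] Every `q_r` is a SINGULAR point of `g₇`: all three first partials vanish there (`∂ₓ`: `r⁷ = r`; `∂_y ≡ 0`; `∂_z`: `7r² = 0`). [folklore] -/
theorem cusp_singular (r : ZMod 7) (j : Fin 3) :
    eval ![r, 4 * r ^ 2 + 1, 1] (pderiv j (X 1 ^ 7 * X 2 - X 0 ^ 8 - 3 * X 0 ^ 2 * X 2 ^ 6 - X 2 ^ 8 : MvPolynomial (Fin 3) (ZMod 7))) = 0 := by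
  fin_cases j
  · rw [show ((⟨0, by decide⟩ : Fin 3)) = 0 from rfl, pderiv_g₇_x]
    simp only [map_sub, map_neg, map_mul, map_pow, eval_X, map_ofNat, Matrix.cons_val_zero, Matrix.cons_val_two,
      Matrix.tail_cons, Matrix.head_cons]
    revert r; decide
  · rw [show ((⟨1, by decide⟩ : Fin 3)) = 1 from rfl, pderiv_g₇_y]
    simp only [map_mul, map_pow, eval_X, map_ofNat, Matrix.cons_val_one, Matrix.cons_val_two, Matrix.tail_cons, Matrix.head_cons]
    revert r; decide
  · rw [show ((⟨2, by decide⟩ : Fin 3)) = 2 from rfl, pderiv_g₇_z]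
    simp only [map_sub, map_mul, map_pow, eval_X, map_ofNat, Matrix.cons_val_zero, Matrix.cons_val_one, Matrix.cons_val_two,
      Matrix.tail_cons, Matrix.head_cons]
    revert r; decide

/-- [OURS · L1 W4.5b] The tangent cone of `g₇` at `q_r` is NOT zero: `∂ₓ∂ₓ g₇(q_r) = −56r⁶ − 6 = 1 ≠ 0` in `𝔽₇` (a double point, cone `u²`). [folklore] -/
theorem pderiv_xx_cusp_ne_zero (r : ZMod 7) :
    eval ![r, 4 * r ^ 2 + 1, 1] (pderiv 0 (pderiv 0 (X 1 ^ 7 * X 2 - X 0 ^ 8 - 3 * X 0 ^ 2 * X 2 ^ 6 - X 2 ^ 8 : MvPolynomial (Fin 3) (ZMod 7)))) ≠ 0 := by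
  rw [pderiv_g₇_xx]
  simp only [map_sub, map_neg, map_mul, map_pow, eval_X, map_ofNat, Matrix.cons_val_zero, Matrix.cons_val_two, Matrix.tail_cons,
    Matrix.head_cons]
  revert r; decide

/-- [OURS · L1 W4.5b] `B♮₁₄(q_r) = 4, 6, 6, 1, 1, 1, 2` for `r = 0, …, 6` (kit j326241 (e) = crit-3's hand values l.85855 = crit-2's tool values l.85858). [folklore] -/
theorem bnat_cusp (r : ZMod 7) :
    eval ![r, 4 * r ^ 2 + 1, 1, 0]
        (X 0 ^ 13 * X 2 + X 0 * X 1 ^ 13 + X 1 * X 2 ^ 13 + 2 * X 0 ^ 7 * X 1 ^ 7 + X 1 ^ 14 + 2 * X 2 ^ 14 +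
          X 3 ^ 2 * (X 0 ^ 12 + X 1 ^ 12 + X 2 ^ 12) + X 3 ^ 14 : MvPolynomial (Fin 4) (ZMod 7)) =
      (![4, 6, 6, 1, 1, 1, 2] : Fin 7 → ZMod 7) r := by
  simp only [map_add, map_mul, map_pow, eval_X, map_ofNat, Matrix.cons_val_zero, Matrix.cons_val_one, Matrix.cons_val_two,
    Matrix.cons_val_three, Matrix.tail_cons, Matrix.head_cons]
  revert r; decide

/-- [OURS · L1 W4.5b] … in particular `B♮₁₄(q_r) ≠ 0` at every cusp: `A′ ≠ 0` at `Sing Z` (NU7 §B1), so in the chart `g = wU` the strict transform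
`U² + B♮ = 0` misses the ambient-singular point `U = 0` over `q_r`, and `Δ = −4B♮ ≠ 0` there (no pinch at a cusp). [folklore] -/
theorem bnat_cusp_ne_zero (r : ZMod 7) :
    eval ![r, 4 * r ^ 2 + 1, 1, 0]
        (X 0 ^ 13 * X 2 + X 0 * X 1 ^ 13 + X 1 * X 2 ^ 13 + 2 * X 0 ^ 7 * X 1 ^ 7 + X 1 ^ 14 + 2 * X 2 ^ 14 +
          X 3 ^ 2 * (X 0 ^ 12 + X 1 ^ 12 + X 2 ^ 12) + X 3 ^ 14 : MvPolynomial (Fin 4) (ZMod 7)) ≠ 0 := by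
  rw [bnat_cusp]
  revert r; decide

/-- [OURS · L1 W4.5b] The STRANGE point `(0 : 1 : 0)` lies on `G₇`, is a smooth point (`∂_z g₇ = 1` there), and `B♮₁₄ = 1` there (no pinch, no cusp). [folklore] -/
theorem strange_point :
    eval ![(0 : ZMod 7), 1, 0] (X 1 ^ 7 * X 2 - X 0 ^ 8 - 3 * X 0 ^ 2 * X 2 ^ 6 - X 2 ^ 8 : MvPolynomial (Fin 3) (ZMod 7)) = 0 ∧
    eval ![(0 : ZMod 7), 1, 0] (pderiv 2 (X 1 ^ 7 * X 2 - X 0 ^ 8 - 3 * X 0 ^ 2 * X 2 ^ 6 - X 2 ^ 8 : MvPolynomial (Fin 3) (ZMod 7))) = 1 ∧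
    eval ![(0 : ZMod 7), 1, 0, 0]
        (X 0 ^ 13 * X 2 + X 0 * X 1 ^ 13 + X 1 * X 2 ^ 13 + 2 * X 0 ^ 7 * X 1 ^ 7 + X 1 ^ 14 + 2 * X 2 ^ 14 +
          X 3 ^ 2 * (X 0 ^ 12 + X 1 ^ 12 + X 2 ^ 12) + X 3 ^ 14 : MvPolynomial (Fin 4) (ZMod 7)) = 1 := by
  refine ⟨?_, ?_, ?_⟩
  · simp [eval_X]
  · rw [pderiv_g₇_z]; simp [eval_X]
  · simp [eval_X]

/-- [OURS · L1 W4.5b] The three second partials at `q_r` combine to a vanishing Hessian block: `∂ₓₓ·∂_yy − ∂ₓ_y² = (1)·(0) − 0 = 0` in `𝔽₇`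
(`∂_yy g₇ = 42y⁵z ≡ 0`). Instance-free numeric core of `hessBlock_cusp_eq_zero`. [folklore] -/
theorem hess_entries_cusp (r : ZMod 7) :
    eval ![r, 4 * r ^ 2 + 1, 1] (pderiv 0 (pderiv 0 (X 1 ^ 7 * X 2 - X 0 ^ 8 - 3 * X 0 ^ 2 * X 2 ^ 6 - X 2 ^ 8 : MvPolynomial (Fin 3) (ZMod 7)))) *
        eval ![r, 4 * r ^ 2 + 1, 1] (pderiv 1 (pderiv 1 (X 1 ^ 7 * X 2 - X 0 ^ 8 - 3 * X 0 ^ 2 * X 2 ^ 6 - X 2 ^ 8 : MvPolynomial (Fin 3) (ZMod 7)))) -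
      eval ![r, 4 * r ^ 2 + 1, 1] (pderiv 0 (pderiv 1 (X 1 ^ 7 * X 2 - X 0 ^ 8 - 3 * X 0 ^ 2 * X 2 ^ 6 - X 2 ^ 8 : MvPolynomial (Fin 3) (ZMod 7)))) ^ 2 = 0 := by
  rw [pderiv_g₇_xx, pderiv_g₇_yy, pderiv_g₇_xy]
  simp only [map_sub, map_neg, map_mul, map_pow, map_zero, eval_X, map_ofNat, Matrix.cons_val_zero, Matrix.cons_val_one,
    Matrix.cons_val_two, Matrix.tail_cons, Matrix.head_cons]
  revert r; decide

section door

variable [Fact (Nat.Prime 7)]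

/-- [OURS · L1 W4.5b] **Door ν4's Hessian block vanishes at every cusp**: `hessBlock g₇ 0 1 (q_r) = ∂ₓₓ·∂_yy − ∂ₓ_y² = 1·0 − 0 = 0`
(…NatResidueHypDefsE `hessBlock`; the tangent cone at `q_r` is a DOUBLE LINE, so `q_r` is not an ORDINARY double point and cannot be a marked vector of
`EqCertAt₀` — whose covering clause then fails at the non-regular point `q_r` of `Z̃`; by hand, memo §4 (ν4)). [folklore] -/
theorem hessBlock_cusp_eq_zero (r : ZMod 7) :
    hessBlock (X 1 ^ 7 * X 2 - X 0 ^ 8 - 3 * X 0 ^ 2 * X 2 ^ 6 - X 2 ^ 8 : MvPolynomial (Fin 3) (ZMod 7)) 0 1 ![r, 4 * r ^ 2 + 1, 1] = 0 := by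
  unfold hessBlock
  exact hess_entries_cusp r

/-- [OURS · L1 W4.5b] The door's restriction along the STANDARD coordinates `B₀` of `Π = V(w)` (`x, y, z ↦ x, y, z`, `w ↦ 0`) kills `ℓ = w`
(clause `restrictToHyperplane B ℓ = 0` of `EqCertAt₀`, …NatResidueHypDefsE). [folklore] -/
theorem restrictToHyperplane_std_w :
    restrictToHyperplane (fun (a : Fin 4) (j : Fin 3) => if (a : ℕ) = j then (1 : ZMod 7) else 0) (X 3 : MvPolynomial (Fin 4) (ZMod 7)) = 0 := by
  unfold restrictToHyperplane
  simp [Fin.sum_univ_three]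

set_option linter.unusedSimpArgs false in -- `map_ofNat` IS used (for `bind₁ _ 3 = 3`); the linter misreports it
/-- [OURS · L1 W4.5b] … and sends the quaternary `g₇` to the ternary `g₇` (so `hessBlock_cusp_eq_zero` / `cusp_singular` are statements about
`restrictToHyperplane B₀ g₇`, the polynomial door ν4 differentiates). [folklore] -/
theorem restrictToHyperplane_std_g₇ :
    restrictToHyperplane (fun (a : Fin 4) (j : Fin 3) => if (a : ℕ) = j then (1 : ZMod 7) else 0)
        (X 1 ^ 7 * X 2 - X 0 ^ 8 - 3 * X 0 ^ 2 * X 2 ^ 6 - X 2 ^ 8 : MvPolynomial (Fin 4) (ZMod 7)) =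
      (X 1 ^ 7 * X 2 - X 0 ^ 8 - 3 * X 0 ^ 2 * X 2 ^ 6 - X 2 ^ 8 : MvPolynomial (Fin 3) (ZMod 7)) := by
  unfold restrictToHyperplane
  simp [Fin.sum_univ_three, map_ofNat]

end door

end charSeven

end SpecimenSnuG7

end Summit.ResolutionOfSingularities.ResolutionOfSingularities.Cruxes.EquisingularLiftNat.Sections

end
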